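import Summits.ResolutionOfSingularities.ResolutionOfSingularities.Theorems.PurelyInseparableDim4ScopeBlindSubst
import HarnessLib

/-!
# UNIFORM-OUT BY SUBSTITUTION, DOMAIN-VALUED: the witness variety given by a point of ANY `K`-algebra domain
# (Laurent / rational-graph loci, polynomial parametrisations, implicit prime quotients) — cell «res-dim4-pi», ∀K column

[OURS · counted 0 · frame bookkeeping] Nothing here is a statement about resolution of singularities.
Seat res-dim4-p-8 g3, for res-dim4-typ-3g9's FCert v2 and res-dim4-eng-w2 g2's leaf-format classes (bus 2026-08-29 01:00Z): of the 162
uniform-out loci of the (2,2) ∀K residue, 51 have a POLYNOMIAL retraction (`…ScopeBlindSubst`, p682570), 35 are 𝔽₄-conjugate plane pairs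
(`…ScopeBlindNormLeaf`), 49 are LAURENT graphs `x_m = −c/a` (`a` a monomial), 6 have a polynomial PARAMETRISATION without retraction,
21 are genus-1 cylinders/cones (implicit only).  One lemma serves the last three classes: let the substitution take values in an
arbitrary commutative `K`-algebra `A` that is a DOMAIN, and let the point `b` be given by a `K`-algebra map `ev : A → K`.

* **`not_inCoordinateScope_translate_of_substHom`** (ring-hom form): `φ : K[x] →+* A` with `φ (X i) = 0` (`i ∈ T`), `φ (X i) ∉ φ(K)`
  (`i ∉ T`), `φ (D^{(α)}G) = 0` for `0 < |α| < q`, `(D^{(α₀)}G)(x_T ↦ 0) ≠ 0` for one `0 < |α₀| < q`, and a point `ev : A →+* K` with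
  `ev ∘ φ = eval b` on scalars and variables ⟹ `¬ InCoordinateScope q (G(x + b))`.  Proof = p682570's with
  `P := ker (φ ∘ translate(−b)) ⊂ K[x]`, prime because `A` is a domain; `P ≤ 𝔪₀` because `ev ∘ φ = eval b`;
* **`not_inCoordinateScope_step_of_substHom`** — the child form (`q = p`, cleaning does not change `J_p⁺`);
* **`not_inCoordinateScope_translate_of_substA`** — the `K`-algebra form (`σ : Fin 4 → A`, `ev : A →ₐ[K] K`, `ev (σ i) = b i`).
(p682570's polynomial lemma is the instance `A = K[x]`, `ev = eval b`.)
Instances: LAURENT — `A = Localization.Away a` (or any domain between `K[x]` and `K(x)`), `σ_m = −c/a`, `ev = ` the extension of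
`eval b` (exists iff `a(b) ≠ 0`); PARAMETRISATION `ψ : K[x] → K[s,t]` — `A = K[s,t]`, `σ = ψ`, `ev = eval (s₀,t₀)`, points `b = ψ(s₀,t₀)`;
IMPLICIT — `A = K[x]/P·K[x]` when `P·K[x]` is prime (absolute primality: NOT certified here — the honest residue).

bears_on: LADDER-RESOLUTION:D157-DOOR2 (res-dim4-pi · ∀K column · leaf lemmas).  Supports stmt-ResolutionOfSingularities-16155 (helper).
-/

set_option linter.dupNamespace false -- mandated namespace of this single-conjunct summit

noncomputable section

open MvPolynomial Finset
open scoped BigOperators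

namespace Summit.ResolutionOfSingularities.ResolutionOfSingularities.Theorems.PIDim4

namespace ScopeBlind

open Literature.AlgebraicGeometry.Resolution
open Literature.AlgebraicGeometry.Resolution.CentreBlowup
open Literature.AlgebraicGeometry.Resolution.Hauser2010
open StepKit ScopeDynamics IsolationCert CurveBlind

variable {K : Type} [Field K] {A : Type} [CommRing A] [IsDomain A]

/-! ## §1 Plumbing: a `K`-point of `A` behind `φ` turns `φ` into `eval b` -/

omit [IsDomain A] in
/-- if `ev ∘ φ` fixes the scalars and sends `xᵢ ↦ bᵢ`, then `ev ∘ φ = eval b` on `K[x₁..x₄]`. [folklore] -/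
theorem ev_comp_eq_eval (φ : MvPolynomial (Fin 4) K →+* A) (ev : A →+* K) (b : Fin 4 → K)
    (hevC : ∀ c : K, ev (φ (C c)) = c) (hevX : ∀ i : Fin 4, ev (φ (X i)) = b i) (g : MvPolynomial (Fin 4) K) :
    ev (φ g) = MvPolynomial.eval b g := by
  have h : ev.comp φ = MvPolynomial.eval b := by
    refine MvPolynomial.ringHom_ext (fun c => ?_) (fun i => ?_)
    · rw [RingHom.comp_apply, hevC, MvPolynomial.eval_C]
    · rw [RingHom.comp_apply, hevX, MvPolynomial.eval_X]
  exact congrArg (fun ψ : MvPolynomial (Fin 4) K →+* K => ψ g) h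

/-! ## §2 The domain-valued substitution lemma (ring-hom form) -/

/-- **UNIFORM-OUT BY A DOMAIN-VALUED SUBSTITUTION.**  Let `A` be a commutative ring without zero divisors and
`φ : K[x₁..x₄] →+* A` («the substitution»: `φ = aeval σ` for `σ i := φ (X i)`) with `φ (X i) = 0` for `i ∈ T` and `φ (X i)` not the
image of a scalar for `i ∉ T`, killing every Hasse derivative `D^{(α)}G`, `0 < |α| < q`; let `(D^{(α₀)}G)(x_T ↦ 0) ≠ 0` for one
`0 < |α₀| < q`.  Then at every point `b` of the witness — a ring map `ev : A →+* K` with `ev ∘ φ = eval b` (checked on scalars and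
variables) — the translated state `G(x + b)` is OUT of coordinate scope.  (p682570 is `A = K[x]`, `φ = aeval σ`, `ev = eval b`;
LAURENT loci: `A = K[x][1/a]`; parametrisations: `A = K[s,t]`; implicit: `A = K[x]/P·K[x]` when prime.) OURS.
[cite: AtiyahMacdonald1969, Ch. 1 (prime ideals; Ex. 1.8)] -/
theorem not_inCoordinateScope_translate_of_substHom {q : ℕ} (G : MvPolynomial (Fin 4) K) (φ : MvPolynomial (Fin 4) K →+* A)
    (T : Finset (Fin 4)) (hφT : ∀ i ∈ T, φ (X i) = 0) (hφ : ∀ i : Fin 4, i ∉ T → ∀ c : K, φ (X i) ≠ φ (C c))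
    (hJ : ∀ α : Fin 4 →₀ ℕ, 0 < α.degree → α.degree < q → φ (hasseDeriv α G) = 0)
    (α₀ : Fin 4 →₀ ℕ) (hα0 : 0 < α₀.degree) (hαq : α₀.degree < q)
    (hW : MvPolynomial.aeval (R := K) (fun i : Fin 4 => if i ∈ T then (0 : MvPolynomial (Fin 4) K) else X i)
      (hasseDeriv α₀ G) ≠ 0)
    (ev : A →+* K) (b : Fin 4 → K) (hevC : ∀ c : K, ev (φ (C c)) = c) (hevX : ∀ i : Fin 4, ev (φ (X i)) = b i) :
    ¬ InCoordinateScope q (PointBlowup.translate b G) := by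
  classical
  have hbT : ∀ i ∈ T, b i = 0 := fun i hi => by rw [← hevX i, hφT i hi, map_zero]
  let τ : MvPolynomial (Fin 4) K →ₐ[K] MvPolynomial (Fin 4) K :=
    MvPolynomial.aeval fun i => (X i + C (-b i) : MvPolynomial (Fin 4) K)
  let ψ : MvPolynomial (Fin 4) K →+* A := φ.comp τ.toRingHom
  have hψ : ∀ g, ψ g = φ (PointBlowup.translate (fun i => -b i) g) := fun g => rfl
  refine IsolationCert.not_inCoordinateScope_of_prime (P := RingHom.ker ψ) (RingHom.ker_isPrime ψ) ?_ ?_ T ?_ ?_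
  · -- `J ≤ ker ψ`
    unfold singLocusIdeal
    rw [Ideal.span_le]
    rintro _ ⟨α, h0, hq, rfl⟩
    rw [SetLike.mem_coe, RingHom.mem_ker, hψ, ScopeDynamics.hasseDeriv_translate, PointBlowup.translate_neg_translate]
    exact hJ α h0 hq
  · -- `ker ψ ≤ 𝔪₀` through the point `ev`
    intro g hg
    rw [RingHom.mem_ker, hψ] at hg
    have h1 := congrArg ev hg
    rw [ev_comp_eq_eval φ ev b hevC hevX, map_zero, eval_translate_add,
      show (b + fun i => -b i) = 0 from funext fun i => by simp] at h1
    unfold originIdeal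
    rw [RingHom.mem_ker]
    exact h1
  · -- no `x_i`, `i ∉ T`, in `ker ψ`
    intro i hi
    by_contra hiT
    rw [RingHom.mem_ker, hψ, translate_def, MvPolynomial.aeval_X, map_add] at hi
    apply hφ i hiT (b i)
    have : φ (X i) = -φ (C (-b i)) := eq_neg_of_add_eq_zero_left hi
    rw [this, ← map_neg, ← C_neg, neg_neg]
  · -- `J ⊄ (x_T)`: kill `x_T` and undo the translation
    intro hle
    have hD : hasseDeriv α₀ (PointBlowup.translate b G) ∈ singLocusIdeal q (PointBlowup.translate b G) :=
      Ideal.subset_span ⟨α₀, hα0, hαq, rfl⟩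
    have hk := aeval_killT_eq_zero_of_mem_span T (hle hD)
    rw [ScopeDynamics.hasseDeriv_translate, aeval_killT_translate T b hbT] at hk
    exact hW (eq_zero_of_translate_eq_zero b hk)

/-- **The frame's child at such a point is OUT of coordinate scope** (`q = p` the characteristic: cleaning does not change `J_p⁺`).
OURS. [folklore] -/
theorem not_inCoordinateScope_step_of_substHom (p : ℕ) [Fact p.Prime] [CharP K p] [DecidableEq K] (S : Finset (Fin 4))
    (j : Fin 4) (s : State K) (φ : MvPolynomial (Fin 4) K →+* A) (T : Finset (Fin 4)) (hφT : ∀ i ∈ T, φ (X i) = 0)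
    (hφ : ∀ i : Fin 4, i ∉ T → ∀ c : K, φ (X i) ≠ φ (C c))
    (hJ : ∀ α : Fin 4 →₀ ℕ, 0 < α.degree → α.degree < p → φ (hasseDeriv α (chartTransform p S j s.F)) = 0)
    (α₀ : Fin 4 →₀ ℕ) (hα0 : 0 < α₀.degree) (hαq : α₀.degree < p)
    (hW : MvPolynomial.aeval (R := K) (fun i : Fin 4 => if i ∈ T then (0 : MvPolynomial (Fin 4) K) else X i)
      (hasseDeriv α₀ (chartTransform p S j s.F)) ≠ 0)
    (ev : A →+* K) (b : Fin 4 → K) (hevC : ∀ c : K, ev (φ (C c)) = c) (hevX : ∀ i : Fin 4, ev (φ (X i)) = b i) :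
    ¬ InCoordinateScope p (CentreBlowup.step p S j b s).F := by
  have hF : (CentreBlowup.step p S j b s).F = deletePthPowers p (PointBlowup.translate b (chartTransform p S j s.F)) := rfl
  unfold InCoordinateScope
  rw [hF, IsolatedBand.singLocusIdeal_deletePthPowers]
  exact not_inCoordinateScope_translate_of_substHom _ φ T hφT hφ hJ α₀ hα0 hαq hW ev b hevC hevX

/-! ## §3 The `K`-algebra form (substitution `σ : Fin 4 → A`, point `ev : A →ₐ[K] K`) -/

/-- **σ-form**: `A` a `K`-algebra domain, `σ : Fin 4 → A`, `ev : A →ₐ[K] K` with `ev (σ i) = b i`. OURS. [folklore] -/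
theorem not_inCoordinateScope_translate_of_substA [Algebra K A] {q : ℕ} (G : MvPolynomial (Fin 4) K) (σ : Fin 4 → A)
    (T : Finset (Fin 4)) (hσT : ∀ i ∈ T, σ i = 0) (hσ : ∀ i : Fin 4, i ∉ T → ∀ c : K, σ i ≠ algebraMap K A c)
    (hJ : ∀ α : Fin 4 →₀ ℕ, 0 < α.degree → α.degree < q → MvPolynomial.aeval σ (hasseDeriv α G) = 0)
    (α₀ : Fin 4 →₀ ℕ) (hα0 : 0 < α₀.degree) (hαq : α₀.degree < q)
    (hW : MvPolynomial.aeval (R := K) (fun i : Fin 4 => if i ∈ T then (0 : MvPolynomial (Fin 4) K) else X i)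
      (hasseDeriv α₀ G) ≠ 0)
    (ev : A →ₐ[K] K) (b : Fin 4 → K) (hb : ∀ i : Fin 4, ev (σ i) = b i) :
    ¬ InCoordinateScope q (PointBlowup.translate b G) :=
  not_inCoordinateScope_translate_of_substHom G (MvPolynomial.aeval σ).toRingHom T (fun i hi => by simp [hσT i hi])
    (fun i hi c => by simpa using hσ i hi c) (fun α h0 hq => by simpa using hJ α h0 hq) α₀ hα0 hαq hW (ev : A →+* K) b
    (fun c => by simp) (fun i => by simpa using hb i)

end ScopeBlind

end Summit.ResolutionOfSingularities.ResolutionOfSingularities.Theorems.PIDim4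

end
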